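import Summits.AtomisticToContinuum.Crystallization.Theorems.FrustratedLawDichotomyCellKitXSound

/-!
# FrustratedLawDichotomy · crux `AperiodicFrustratedLawGap` (stmt-AtomisticToContinuum-27623) — CELL KIT X, SOUNDNESS II: the hypotheses of the
# closed-form move certificate from the rational checks (decomp-a2c, prover hand 2, generation 17; critic row 592 (3))

For a cell `c` with hand-1's geometry check passed, parameters `P`, a class move certificate `X` and class `m` (centre `j = cellIdx m`, local set
`K = {k ≠ j : dist (zM k) (zM j) ≤ Rm}`), this file turns the pieces of `checkMove c P X m` into the hypotheses of
`…CollarNonExempt.not_moveUnstableCore_of_bregmanCert_closed` with the data `c k := cOf X.bins n_k`, `Plo k := (rlo − s)²`, `Phi k := (rhi + s)²` of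
the bin of `n_k`:
* §1 sum bridges (`sumX_eq_localSum`, `sumX_le_localSum`) and the five sums: `S_lo ≤ Σ_K Ṽ'` (`hS_of_check`), the exact matrix / vector / scalar sums
  (`hC_of_check`, `hB_of_check`, `hC4_of_check`), the force enclosure `|Σ_K 2Ṽ' w_a − f_a| ≤ τ` (`hF_enclosure`);
* §2 bins: `exists_bin_of_cover`, `bin_facts`, ★ `hrange_of_check`, ★ `hbreg_of_check` (via `…CollarNonExemptBins.bregman_ge_of_bin_chain`).
The assembly `checkMove = true ⟹ ¬MoveUnstableCore` is `…CellKitXKill`.  All `[folklore]`; 0 sorry.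
-/

noncomputable section

namespace Summit.AtomisticToContinuum.Crystallization.Theorems.FrustratedLawDichotomyCellKitX

open scoped BigOperators RealInnerProductSpace
open Literature.Geometry.DiscreteGeometry (sqNormInt)
open Literature.MathematicalPhysics.StatisticalMechanics (lennardJones)
open Summit.AtomisticToContinuum.Crystallization.Theorems.ChargedEnergyGapNegative (E3)
open Summit.AtomisticToContinuum.Crystallization.Theorems.FrustratedLawDichotomyCellChecker
  (Cell roundUp le_roundUp allBelow sumBelow allBelow_spec sumBelow_eq)
open Summit.AtomisticToContinuum.Crystallization.Theorems.FrustratedLawDichotomyCellKitF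
  (cellμ cellσ cellIdx cellMid cellμσ_injective sum_cell_eq cellIdx_spec)
open Summit.AtomisticToContinuum.Crystallization.Theorems.FrustratedLawDichotomyPeriodicBlockKernel (PerSep superMotif_injective)
open Summit.AtomisticToContinuum.Crystallization.Theorems.FrustratedLawDichotomyCollarNonExemptBins (bregman_ge_of_bin_chain sq_dist_mem_range_bin)

variable (c : Cell)

/-! ## §1. Sum bridges -/

/-- Generic bridge: a hand-1-shaped sum whose summand is `if inRange n then v else 0` equals the real sum of `v` over the local set. [folklore] -/
theorem sumX_eq_localSum (hD : 0 < c.DEN) (hsep : PerSep c.x c.a) (P : XParams) (hRm : 0 ≤ P.Rm) (m : Fin c.N₀) (g : Fin c.N₀ → ℕ → ℚ)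
    (v : Fin (c.N₀ * c.K3) → ℝ)
    (hg : ∀ q : Fin (c.N₀ * c.K3), ((g (cellμ c.N₀ c.k₀ q) (finProdFinEquiv.symm q).2 : ℚ) : ℝ) = if inRange c P (nq c m q) then v q else 0) :
    ((sumX c g : ℚ) : ℝ) =
      ∑ q ∈ (Finset.univ.erase (cellIdx c.N₀ c.k₀ m)).filter (fun k => dist (c.zM k) (c.zM (cellIdx c.N₀ c.k₀ m)) ≤ (P.Rm : ℝ)), v q := by
  rw [cast_sumX, ← sum_ite_inRange c hD hsep P hRm m v]
  exact Finset.sum_congr rfl fun q _ => hg q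

/-- Bridge for a lower bound: summand `if inRange n then u else 0` with `u ≤ v` in range. [folklore] -/
theorem sumX_le_localSum (hD : 0 < c.DEN) (hsep : PerSep c.x c.a) (P : XParams) (hRm : 0 ≤ P.Rm) (m : Fin c.N₀) (g : Fin c.N₀ → ℕ → ℚ)
    (u v : Fin (c.N₀ * c.K3) → ℝ)
    (hg : ∀ q : Fin (c.N₀ * c.K3), ((g (cellμ c.N₀ c.k₀ q) (finProdFinEquiv.symm q).2 : ℚ) : ℝ) = if inRange c P (nq c m q) then u q else 0)
    (huv : ∀ q, inRange c P (nq c m q) = true → u q ≤ v q) :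
    ((sumX c g : ℚ) : ℝ) ≤
      ∑ q ∈ (Finset.univ.erase (cellIdx c.N₀ c.k₀ m)).filter (fun k => dist (c.zM k) (c.zM (cellIdx c.N₀ c.k₀ m)) ≤ (P.Rm : ℝ)), v q := by
  rw [sumX_eq_localSum c hD hsep P hRm m g u hg]
  exact Finset.sum_le_sum fun q hq => huv q ((mem_localSet_iff c hD hsep P hRm m q).1 hq)

/-- Bridge for an upper bound. [folklore] -/
theorem localSum_le_sumX (hD : 0 < c.DEN) (hsep : PerSep c.x c.a) (P : XParams) (hRm : 0 ≤ P.Rm) (m : Fin c.N₀) (g : Fin c.N₀ → ℕ → ℚ)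
    (u v : Fin (c.N₀ * c.K3) → ℝ)
    (hg : ∀ q : Fin (c.N₀ * c.K3), ((g (cellμ c.N₀ c.k₀ q) (finProdFinEquiv.symm q).2 : ℚ) : ℝ) = if inRange c P (nq c m q) then u q else 0)
    (hvu : ∀ q, inRange c P (nq c m q) = true → v q ≤ u q) :
    (∑ q ∈ (Finset.univ.erase (cellIdx c.N₀ c.k₀ m)).filter (fun k => dist (c.zM k) (c.zM (cellIdx c.N₀ c.k₀ m)) ≤ (P.Rm : ℝ)), v q) ≤
      ((sumX c g : ℚ) : ℝ) := by
  rw [sumX_eq_localSum c hD hsep P hRm m g u hg]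
  exact Finset.sum_le_sum fun q hq => hvu q ((mem_localSet_iff c hD hsep P hRm m q).1 hq)

/-- `S_lo ≤ Σ_K Ṽ'(Q_k)`. [folklore] -/
theorem hS_of_check (hD : 0 < c.DEN) (hsep : PerSep c.x c.a) (P : XParams) (hRm : 0 ≤ P.Rm) (m : Fin c.N₀) :
    ((sumX c (termS c P m) : ℚ) : ℝ) ≤
      ∑ k ∈ (Finset.univ.erase (cellIdx c.N₀ c.k₀ m)).filter (fun k => dist (c.zM k) (c.zM (cellIdx c.N₀ c.k₀ m)) ≤ (P.Rm : ℝ)),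
        (-(1 / 2) * (dist (c.zM (cellIdx c.N₀ c.k₀ m)) (c.zM k) ^ 2)⁻¹ ^ 7 + (1 / 2) * (dist (c.zM (cellIdx c.N₀ c.k₀ m)) (c.zM k) ^ 2)⁻¹ ^ 4) := by
  refine sumX_le_localSum c hD hsep P hRm m _ (fun q => ((roundDown (dvT c.DEN (nq c m q).toNat) : ℚ) : ℝ)) _ ?_ ?_
  · intro q; unfold termS nq; split_ifs <;> simp
  · intro q hq
    rw [dV_eq_dvT c hD hq]; exact_mod_cast roundDown_le _

/-- The exact matrix sums: `Σ termC a b = 4 Σ_K c_k (w_k)_a (w_k)_b`. [folklore] -/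
theorem hC_of_check (hD : 0 < c.DEN) (hsep : PerSep c.x c.a) (P : XParams) (hRm : 0 ≤ P.Rm) (bins : List MoveBin) (m : Fin c.N₀) (a b : Fin 3) :
    ((sumX c (termC c P bins a b m) : ℚ) : ℝ) =
      4 * ∑ k ∈ (Finset.univ.erase (cellIdx c.N₀ c.k₀ m)).filter (fun k => dist (c.zM k) (c.zM (cellIdx c.N₀ c.k₀ m)) ≤ (P.Rm : ℝ)),
        ((cOf bins (nq c m k) : ℚ) : ℝ) * ((c.zM (cellIdx c.N₀ c.k₀ m) - c.zM k) a * (c.zM (cellIdx c.N₀ c.k₀ m) - c.zM k) b) := by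
  have hD' : (0 : ℝ) < c.DEN := by exact_mod_cast hD
  rw [Finset.mul_sum]
  refine sumX_eq_localSum c hD hsep P hRm m _ _ ?_
  intro q
  unfold termC nq
  split_ifs with hq
  · rw [bond_coord, bond_coord]; push_cast; field_simp
  · simp

/-- The exact vector sums: `Σ termB a = Σ_K (4 c_k) (w_k)_a`. [folklore] -/
theorem hB_of_check (hD : 0 < c.DEN) (hsep : PerSep c.x c.a) (P : XParams) (hRm : 0 ≤ P.Rm) (bins : List MoveBin) (m : Fin c.N₀) (a : Fin 3) :
    ((sumX c (termB c P bins a m) : ℚ) : ℝ) =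
      ∑ k ∈ (Finset.univ.erase (cellIdx c.N₀ c.k₀ m)).filter (fun k => dist (c.zM k) (c.zM (cellIdx c.N₀ c.k₀ m)) ≤ (P.Rm : ℝ)),
        (4 * ((cOf bins (nq c m k) : ℚ) : ℝ)) * (c.zM (cellIdx c.N₀ c.k₀ m) - c.zM k) a := by
  have hD' : (0 : ℝ) < c.DEN := by exact_mod_cast hD
  refine sumX_eq_localSum c hD hsep P hRm m _ _ ?_
  intro q
  unfold termB nq
  split_ifs with hq
  · rw [bond_coord]; push_cast; field_simp
  · simp

/-- The exact scalar sum: `Σ termC4 = Σ_K c_k`. [folklore] -/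
theorem hC4_of_check (hD : 0 < c.DEN) (hsep : PerSep c.x c.a) (P : XParams) (hRm : 0 ≤ P.Rm) (bins : List MoveBin) (m : Fin c.N₀) :
    ((sumX c (termC4 c P bins m) : ℚ) : ℝ) =
      ∑ k ∈ (Finset.univ.erase (cellIdx c.N₀ c.k₀ m)).filter (fun k => dist (c.zM k) (c.zM (cellIdx c.N₀ c.k₀ m)) ≤ (P.Rm : ℝ)),
        ((cOf bins (nq c m k) : ℚ) : ℝ) := by
  refine sumX_eq_localSum c hD hsep P hRm m _ _ ?_
  intro q; unfold termC4 nq; split_ifs <;> simp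

/-- ★ The force enclosure: `|Σ_K 2Ṽ'(Q_k)(w_k)_a − f_a| ≤ τ = N₀K³/2⁴⁰` (each term is rounded down by at most `2⁻⁴⁰`). [folklore] -/
theorem hF_enclosure (hD : 0 < c.DEN) (hsep : PerSep c.x c.a) (P : XParams) (hRm : 0 ≤ P.Rm) (m : Fin c.N₀) (a : Fin 3) :
    |(∑ k ∈ (Finset.univ.erase (cellIdx c.N₀ c.k₀ m)).filter (fun k => dist (c.zM k) (c.zM (cellIdx c.N₀ c.k₀ m)) ≤ (P.Rm : ℝ)),
        2 * (-(1 / 2) * (dist (c.zM (cellIdx c.N₀ c.k₀ m)) (c.zM k) ^ 2)⁻¹ ^ 7 + (1 / 2) * (dist (c.zM (cellIdx c.N₀ c.k₀ m)) (c.zM k) ^ 2)⁻¹ ^ 4) *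
          (c.zM (cellIdx c.N₀ c.k₀ m) - c.zM k) a) - ((sumX c (termF c P a m) : ℚ) : ℝ)| ≤ ((tauOf c : ℚ) : ℝ) := by
  have hD' : (0 : ℝ) < c.DEN := by exact_mod_cast hD
  -- the exact per-bond rational `x q = 2Ṽ'(Q) · (−z_a/DEN)` and its identity with the real term
  have hxq : ∀ q, inRange c P (nq c m q) = true →
      (((2 * dvT c.DEN (nq c m q).toNat * (-(zvec c m (cellμ c.N₀ c.k₀ q) (finProdFinEquiv.symm q).2 a : ℚ)) / c.DEN : ℚ)) : ℝ) =
        2 * (-(1 / 2) * (dist (c.zM (cellIdx c.N₀ c.k₀ m)) (c.zM q) ^ 2)⁻¹ ^ 7 +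
          (1 / 2) * (dist (c.zM (cellIdx c.N₀ c.k₀ m)) (c.zM q) ^ 2)⁻¹ ^ 4) * (c.zM (cellIdx c.N₀ c.k₀ m) - c.zM q) a := by
    intro q hq
    rw [dV_eq_dvT c hD hq, bond_coord]; push_cast; field_simp
  have hg : ∀ q : Fin (c.N₀ * c.K3), ((termF c P a m (cellμ c.N₀ c.k₀ q) (finProdFinEquiv.symm q).2 : ℚ) : ℝ) =
      if inRange c P (nq c m q) then
        ((roundDown (2 * dvT c.DEN (nq c m q).toNat * (-(zvec c m (cellμ c.N₀ c.k₀ q) (finProdFinEquiv.symm q).2 a : ℚ)) / c.DEN) : ℚ) : ℝ)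
      else 0 := by
    intro q; unfold termF nq; split_ifs <;> first | rfl | simp
  have hlo := sumX_le_localSum c hD hsep P hRm m _
    (fun q => ((roundDown (2 * dvT c.DEN (nq c m q).toNat * (-(zvec c m (cellμ c.N₀ c.k₀ q) (finProdFinEquiv.symm q).2 a : ℚ)) / c.DEN) : ℚ) : ℝ))
    (fun q => 2 * (-(1 / 2) * (dist (c.zM (cellIdx c.N₀ c.k₀ m)) (c.zM q) ^ 2)⁻¹ ^ 7 +
        (1 / 2) * (dist (c.zM (cellIdx c.N₀ c.k₀ m)) (c.zM q) ^ 2)⁻¹ ^ 4) * (c.zM (cellIdx c.N₀ c.k₀ m) - c.zM q) a)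
    hg (fun q hq => by rw [← hxq q hq]; exact_mod_cast roundDown_le _)
  have hhi := localSum_le_sumX c hD hsep P hRm m _
    (fun q => ((roundDown (2 * dvT c.DEN (nq c m q).toNat * (-(zvec c m (cellμ c.N₀ c.k₀ q) (finProdFinEquiv.symm q).2 a : ℚ)) / c.DEN) : ℚ) : ℝ))
    (fun q => 2 * (-(1 / 2) * (dist (c.zM (cellIdx c.N₀ c.k₀ m)) (c.zM q) ^ 2)⁻¹ ^ 7 +
        (1 / 2) * (dist (c.zM (cellIdx c.N₀ c.k₀ m)) (c.zM q) ^ 2)⁻¹ ^ 4) * (c.zM (cellIdx c.N₀ c.k₀ m) - c.zM q) a - 1 / 2 ^ 40) hg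
    (fun q hq => by
      rw [← hxq q hq]
      have := (Rat.cast_le (K := ℝ)).2
        (sub_roundDown_le (2 * dvT c.DEN (nq c m q).toNat * (-(zvec c m (cellμ c.N₀ c.k₀ q) (finProdFinEquiv.symm q).2 a : ℚ)) / c.DEN))
      push_cast at this ⊢
      linarith)
  rw [Finset.sum_sub_distrib, Finset.sum_const, nsmul_eq_mul] at hhi
  -- `|K| ≤ N₀K³`
  have hcard : (((Finset.univ.erase (cellIdx c.N₀ c.k₀ m)).filter
      (fun k => dist (c.zM k) (c.zM (cellIdx c.N₀ c.k₀ m)) ≤ (P.Rm : ℝ))).card : ℝ) ≤ (c.N₀ * c.K3 : ℕ) := by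
    have h1 := Finset.card_le_univ ((Finset.univ.erase (cellIdx c.N₀ c.k₀ m)).filter
      (fun k => dist (c.zM k) (c.zM (cellIdx c.N₀ c.k₀ m)) ≤ (P.Rm : ℝ)))
    rw [Fintype.card_fin] at h1
    exact_mod_cast h1
  have hτ : ((tauOf c : ℚ) : ℝ) = ((c.N₀ * c.K3 : ℕ) : ℝ) / 2 ^ 40 := by unfold tauOf; push_cast; ring
  rw [hτ, abs_le]
  constructor
  · have : (((Finset.univ.erase (cellIdx c.N₀ c.k₀ m)).filter
        (fun k => dist (c.zM k) (c.zM (cellIdx c.N₀ c.k₀ m)) ≤ (P.Rm : ℝ))).card : ℝ) * (1 / 2 ^ 40) ≤ ((c.N₀ * c.K3 : ℕ) : ℝ) / 2 ^ 40 := by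
      rw [mul_one_div]; exact div_le_div_of_nonneg_right hcard (by positivity)
    linarith
  · have : (0 : ℝ) ≤ ((c.N₀ * c.K3 : ℕ) : ℝ) / 2 ^ 40 := by positivity
    linarith

/-! ## §2. Bins -/

/-- From the cover check: an in-range point lies in some bin of the list, and `cOf` returns that bin's constant. [folklore] -/
theorem exists_bin_of_cover {P : XParams} {X : XCert} {m : Fin c.N₀} (h : checkCover c P X m = true) (q : Fin (c.N₀ * c.K3))
    (hin : inRange c P (nq c m q) = true) :
    ∃ b ∈ X.bins, binOf X.bins (nq c m q) = some b ∧ (b.nlo : ℤ) ≤ nq c m q ∧ nq c m q ≤ (b.nhi : ℤ) ∧ cOf X.bins (nq c m q) = b.cst := by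
  rw [checkCover, decide_eq_true_eq] at h
  have ht := allBelow_spec (h (cellμ c.N₀ c.k₀ q)) _ ((finProdFinEquiv.symm q).2).2
  have ht' : (!inRange c P (nq c m q) || (binOf X.bins (nq c m q)).isSome) = true := ht
  rw [hin] at ht'
  simp only [Bool.not_true, Bool.false_or] at ht'
  obtain ⟨b, hb⟩ := Option.isSome_iff_exists.1 ht'
  have hmem := List.mem_of_find?_eq_some hb
  have hpred := List.find?_some hb
  simp only [Bool.and_eq_true, decide_eq_true_eq] at hpred
  refine ⟨b, hmem, hb, hpred.1, hpred.2, ?_⟩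
  simp [cOf, hb]

/-- From the bins check: the facts certified for one bin. [folklore] -/
theorem bin_facts {P : XParams} {X : XCert} (h : checkBins c P X = true) {b : MoveBin} (hb : b ∈ X.bins) :
    0 < b.nlo ∧ b.nlo ≤ b.nhi ∧ 0 ≤ b.rlo ∧ 0 ≤ b.rhi ∧ b.rlo ^ 2 * (c.DEN : ℚ) ^ 2 ≤ b.nlo ∧ (b.nhi : ℚ) ≤ b.rhi ^ 2 * (c.DEN : ℚ) ^ 2 ∧
      P.s < b.rlo ∧ 0 < X.npieces ∧
      ∀ i, i < X.npieces → 12 * b.cst ≤ posQ ((c.DEN : ℚ) ^ 2 / b.nhi) (b.node P.s X.npieces (i + 1))⁻¹ -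
        negQ ((c.DEN : ℚ) ^ 2 / b.nlo) (b.node P.s X.npieces i)⁻¹ := by
  rw [checkBins, List.all_eq_true] at h
  have hb' := h b hb
  simp only [checkBin, Bool.and_eq_true, decide_eq_true_eq] at hb'
  obtain ⟨⟨⟨⟨⟨⟨⟨⟨h1, h2⟩, h3⟩, h4⟩, h5⟩, h6⟩, h7⟩, h8⟩, h9⟩ := hb'
  refine ⟨h1, h2, h3, h4, h5, h6, h7, h8, fun i hi => ?_⟩
  have := allBelow_spec h9 i hi
  simpa using this

/-- ★ `hrange` from the cover and the bins' length enclosures. [folklore] -/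
theorem hrange_of_check (hD : 0 < c.DEN) (hsep : PerSep c.x c.a) {P : XParams} (hRm : 0 ≤ P.Rm) {X : XCert} {m : Fin c.N₀}
    (hbins : checkBins c P X = true) (hcover : checkCover c P X m = true) :
    ∀ k ∈ (Finset.univ.erase (cellIdx c.N₀ c.k₀ m)).filter (fun k => dist (c.zM k) (c.zM (cellIdx c.N₀ c.k₀ m)) ≤ (P.Rm : ℝ)),
      ∀ p : EuclideanSpace ℝ (Fin 3), dist p (c.zM (cellIdx c.N₀ c.k₀ m)) ≤ (P.s : ℝ) →
        ((((binOf X.bins (nq c m k)).map fun b => (b.rlo - P.s) ^ 2).getD 0 : ℚ) : ℝ) ≤ dist p (c.zM k) ^ 2 ∧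
          dist p (c.zM k) ^ 2 ≤ ((((binOf X.bins (nq c m k)).map fun b => (b.rhi + P.s) ^ 2).getD 0 : ℚ) : ℝ) := by
  intro k hk p hp
  have hD' : (0 : ℝ) < c.DEN := by exact_mod_cast hD
  have hin := (mem_localSet_iff c hD hsep P hRm m k).1 hk
  obtain ⟨b, hb, hsome, hlo, hhi, -⟩ := exists_bin_of_cover c hcover k hin
  obtain ⟨h1, -, h3, h4, h5, h6, h7, -, -⟩ := bin_facts c hbins hb
  rw [hsome]
  simp only [Option.map_some, Option.getD_some]
  push_cast
  have hQ := sq_dist_eq c hD m k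
  have hloR : ((b.rlo : ℝ)) ^ 2 ≤ dist (c.zM (cellIdx c.N₀ c.k₀ m)) (c.zM k) ^ 2 := by
    rw [hQ, le_div_iff₀ (by positivity)]
    have e1 : ((b.rlo : ℝ)) ^ 2 * (c.DEN : ℝ) ^ 2 ≤ (b.nlo : ℝ) := by exact_mod_cast h5
    have e2 : ((b.nlo : ℤ) : ℝ) ≤ (nq c m k : ℝ) := by exact_mod_cast hlo
    push_cast at e2; linarith
  have hhiR : dist (c.zM (cellIdx c.N₀ c.k₀ m)) (c.zM k) ^ 2 ≤ ((b.rhi : ℝ)) ^ 2 := by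
    rw [hQ, div_le_iff₀ (by positivity)]
    have e1 : (b.nhi : ℝ) ≤ ((b.rhi : ℝ)) ^ 2 * (c.DEN : ℝ) ^ 2 := by exact_mod_cast h6
    have e2 : (nq c m k : ℝ) ≤ ((b.nhi : ℤ) : ℝ) := by exact_mod_cast hhi
    push_cast at e2; linarith
  exact sq_dist_mem_range_bin (by exact_mod_cast h3) (by exact_mod_cast h4) hloR hhiR (by exact_mod_cast h7.le) hp

/-- The chain nodes: endpoints and monotonicity. [folklore] -/
theorem node_facts (b : MoveBin) (s : ℚ) {np : ℕ} (hnp : 0 < np) (hle : (b.rlo - s) ^ 2 ≤ (b.rhi + s) ^ 2) :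
    b.node s np 0 = (b.rlo - s) ^ 2 ∧ b.node s np np = (b.rhi + s) ^ 2 ∧ ∀ i, i < np → b.node s np i ≤ b.node s np (i + 1) := by
  have hnp' : (np : ℚ) ≠ 0 := by exact_mod_cast hnp.ne'
  refine ⟨by simp [MoveBin.node], by unfold MoveBin.node; field_simp; ring, fun i _ => ?_⟩
  unfold MoveBin.node
  have : ((b.rhi + s) ^ 2 - (b.rlo - s) ^ 2) * (i : ℚ) / np ≤ ((b.rhi + s) ^ 2 - (b.rlo - s) ^ 2) * ((i + 1 : ℕ) : ℚ) / np := by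
    apply div_le_div_of_nonneg_right _ (by positivity)
    exact mul_le_mul_of_nonneg_left (by push_cast; linarith) (by linarith)
  linarith

/-- ★ `hbreg` from the cover and the bins' chain condition. [folklore] -/
theorem hbreg_of_check (hD : 0 < c.DEN) (hsep : PerSep c.x c.a) {P : XParams} (hs : 0 ≤ P.s) (hRm : 0 ≤ P.Rm) {X : XCert} {m : Fin c.N₀}
    (hbins : checkBins c P X = true) (hcover : checkCover c P X m = true) :
    ∀ k ∈ (Finset.univ.erase (cellIdx c.N₀ c.k₀ m)).filter (fun k => dist (c.zM k) (c.zM (cellIdx c.N₀ c.k₀ m)) ≤ (P.Rm : ℝ)),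
      ∀ Pv : ℝ, ((((binOf X.bins (nq c m k)).map fun b => (b.rlo - P.s) ^ 2).getD 0 : ℚ) : ℝ) ≤ Pv →
        Pv ≤ ((((binOf X.bins (nq c m k)).map fun b => (b.rhi + P.s) ^ 2).getD 0 : ℚ) : ℝ) →
        ((cOf X.bins (nq c m k) : ℚ) : ℝ) * (Pv - dist (c.zM (cellIdx c.N₀ c.k₀ m)) (c.zM k) ^ 2) ^ 2 ≤
          ((1 / 12) * Pv⁻¹ ^ 6 - (1 / 6) * Pv⁻¹ ^ 3) -
            ((1 / 12) * (dist (c.zM (cellIdx c.N₀ c.k₀ m)) (c.zM k) ^ 2)⁻¹ ^ 6 - (1 / 6) * (dist (c.zM (cellIdx c.N₀ c.k₀ m)) (c.zM k) ^ 2)⁻¹ ^ 3) -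
            (-(1 / 2) * (dist (c.zM (cellIdx c.N₀ c.k₀ m)) (c.zM k) ^ 2)⁻¹ ^ 7 + (1 / 2) * (dist (c.zM (cellIdx c.N₀ c.k₀ m)) (c.zM k) ^ 2)⁻¹ ^ 4) *
              (Pv - dist (c.zM (cellIdx c.N₀ c.k₀ m)) (c.zM k) ^ 2) := by
  intro k hk Pv hP1 hP2
  have hD' : (0 : ℝ) < c.DEN := by exact_mod_cast hD
  have hin := (mem_localSet_iff c hD hsep P hRm m k).1 hk
  obtain ⟨b, hb, hsome, hlo, hhi, hcst⟩ := exists_bin_of_cover c hcover k hin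
  obtain ⟨h1, h2, h3, h4, h5, h6, h7, h8, h9⟩ := bin_facts c hbins hb
  rw [hsome] at hP1 hP2
  simp only [Option.map_some, Option.getD_some] at hP1 hP2
  rw [hcst]
  -- `rlo ≤ rhi`, hence the move range is a genuine interval
  have hrr : b.rlo ≤ b.rhi := by
    have : b.rlo ^ 2 * (c.DEN : ℚ) ^ 2 ≤ b.rhi ^ 2 * (c.DEN : ℚ) ^ 2 :=
      h5.trans ((by exact_mod_cast h2 : (b.nlo : ℚ) ≤ b.nhi).trans h6)
    have hD2 : (0 : ℚ) < (c.DEN : ℚ) ^ 2 := by positivity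
    have hsq : b.rlo ^ 2 ≤ b.rhi ^ 2 := le_of_mul_le_mul_right this hD2
    exact (pow_le_pow_iff_left₀ h3 h4 two_ne_zero).1 hsq
  have hle : (b.rlo - P.s) ^ 2 ≤ (b.rhi + P.s) ^ 2 := pow_le_pow_left₀ (by linarith) (by linarith) 2
  obtain ⟨hn0, hnn, hmono⟩ := node_facts b P.s h8 hle
  have hQ := sq_dist_eq c hD m k
  -- the chain lemma at real casts
  have key := bregman_ge_of_bin_chain (fun i => ((b.node P.s X.npieces i : ℚ) : ℝ)) (n := X.npieces)
    (Qlo := (b.nlo : ℝ) / (c.DEN : ℝ) ^ 2) (Qhi := (b.nhi : ℝ) / (c.DEN : ℝ) ^ 2) (c := (b.cst : ℝ))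
    (by have : (0 : ℝ) < b.nlo := by exact_mod_cast h1
        positivity)
    (by rw [hn0]; push_cast; have : (P.s : ℝ) < b.rlo := by exact_mod_cast h7
        nlinarith)
    (fun i hi => by exact_mod_cast hmono i hi) h8
    (fun i hi => by
      have hq := h9 i hi
      have hc := (Rat.cast_le (K := ℝ)).2 hq
      simp only [posQ, negQ] at hc
      push_cast at hc
      rw [inv_div, inv_div]
      convert hc using 2)
  have hQ1 : (b.nlo : ℝ) / (c.DEN : ℝ) ^ 2 ≤ dist (c.zM (cellIdx c.N₀ c.k₀ m)) (c.zM k) ^ 2 := by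
    rw [hQ]; apply div_le_div_of_nonneg_right _ (by positivity)
    have e2 : ((b.nlo : ℤ) : ℝ) ≤ (nq c m k : ℝ) := by exact_mod_cast hlo
    push_cast at e2; exact e2
  have hQ2 : dist (c.zM (cellIdx c.N₀ c.k₀ m)) (c.zM k) ^ 2 ≤ (b.nhi : ℝ) / (c.DEN : ℝ) ^ 2 := by
    rw [hQ]; apply div_le_div_of_nonneg_right _ (by positivity)
    have e2 : (nq c m k : ℝ) ≤ ((b.nhi : ℤ) : ℝ) := by exact_mod_cast hhi
    push_cast at e2; exact e2
  have hE0 : ((b.node P.s X.npieces 0 : ℚ) : ℝ) ≤ Pv := by rw [hn0]; exact hP1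
  have hEn : Pv ≤ ((b.node P.s X.npieces X.npieces : ℚ) : ℝ) := by rw [hnn]; exact hP2
  exact key _ Pv hQ1 hQ2 hE0 hEn

end Summit.AtomisticToContinuum.Crystallization.Theorems.FrustratedLawDichotomyCellKitX

end
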